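import Literature.AlgebraicGeometry.GroupSchemes.AffineGroupSchemeOfHopfAlgebra
import Mathlib.RingTheory.Bialgebra.Equiv
import HarnessLib

/-!
# The round trip `Γ(Spec H, 𝒪) ≃ H` is an isomorphism of Hopf algebras (Görtz–Wedhorn II §(27.2), Def. 27.6)

Layer `Literature/AlgebraicGeometry/GroupSchemes`, namespace `Literature.AlgebraicGeometry.GroupSchemes.AffineGroupScheme` (continues ★
`AffineGroupSchemeHopfAlgebra` p844646 — `G ↦ Alg G = Γ(G, 𝒪_G)` with the Hopf structure of its functorial group law `groupLaw G` —, ★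
`AffineGroupSchemeSpecPoints` p844773 — `algSpecOverEquiv H : Alg (specOver R H) ≃ₐ[R] H` — and ★ `AffineGroupSchemeOfHopfAlgebra` p845155 —
`H ↦ grpObjOfHopfAlgebra R H : GrpObj (specOver R H)`).  One small `def` (the bialgebra equivalence `algSpecOverBialgEquiv`) + theorems; no
instance, no notation, no named fact, no `sorry`.  Cell `hodgecm-mathlib` (D-0151), programme P6 «MOD», HEART organ GAP-1 clause **(v) «ROUND
TRIP»** (B-p04 (g36) banked it; B-p04 (g37)): the algebra input of the bidual clause `(G^D)^D ≅ G` of the scheme-level Cartier dual (A-p17 (g24)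
ST-0 census, gap (g1)) and of reading the ★ `FiniteDual*` files (CD2-bidual, CD2-bc, CD3) on `Spec B^*`.  Count-neutral Mathlib-side capital:
HC_CM is proved only modulo the 7 printed citations until rung 0 closes; nothing here bears on it.

THE PRINT ([GortzWedhorn2023] §(27.2), (27.2.1), Def. 27.6, pp. 606–607): the two constructions «affine group scheme `G` ↦ commutative Hopf
algebra `Γ(G, 𝒪_G)`» and «commutative Hopf algebra `H` ↦ affine group scheme `Spec H`» are inverse to each other.  The tree has both arrows
(★ p844646, ★ p845155) and `Γ(Spec H, 𝒪) ≃ₐ[R] H` as `R`-ALGEBRAS (★ `algSpecOverEquiv H`); this file proves that, for the group object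
`grpObjOfHopfAlgebra R H` on `specOver R H = (Spec H → Spec R)`, that algebra isomorphism carries the functorial group law
`groupLaw (specOver R H)` (products ∕ unit ∕ inverses of points) to the convolution law `lawOfHopfAlgebra R H`, hence is an isomorphism of
BIALGEBRAS commuting with the antipodes — i.e. of Hopf algebras (Mathlib has no separate Hopf-morphism type).

* §1 the two point dictionaries agree: `coord_specOverMapOfAlgHom` (the coordinates of `Spec ψ` are `ψ` read through `Γ(Spec R′) ≅ R′`),
  **`algSpecOverEquiv_comp_coord`** (`(Γ(Spec R′) ≅ R′) ∘ coord u = ptEquiv u ∘ (Γ(Spec H) ≅ H)⁻¹` for `u : specOver R R′ ⟶ specOver R H`);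
* §2 the laws agree, for `e := algSpecOverEquiv H`: **`groupLaw_mul_comp_algSpecOverEquiv_symm`** (`(φ · χ) ∘ e⁻¹ = (φ ∘ e⁻¹) ⋆ (χ ∘ e⁻¹)`,
  the convolution law), `groupLaw_one_comp_algSpecOverEquiv_symm`, `groupLaw_inv_comp_algSpecOverEquiv_symm`;
* §3 the Hopf structures agree: `comulAlgHom_alg_eq` ∕ `counitAlgHom_alg_eq` ∕ `antipode_alg_eq` (bridges to ★ `CorepGroupLaw.comul ∕ counit ∕
  antipodeAlgHom` for ANY affine group scheme), `comulAlgHom_comp_algSpecOverEquiv_symm`, **`map_algSpecOverEquiv_comp_comulAlgHom`**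
  (`(e ⊗ e) ∘ Δ_{Γ(Spec H)} = Δ_H ∘ e`), **`counitAlgHom_comp_algSpecOverEquiv`** (`ε_H ∘ e = ε_{Γ(Spec H)}`), HEAD
  **`algSpecOverBialgEquiv H : Alg (specOver R H) ≃ₐc[R] H`** (Mathlib `BialgEquiv.ofAlgEquiv`), and **`algSpecOverEquiv_antipode`**
  (`e (S a) = S (e a)`).

## References
* [GortzWedhorn2023] U. Görtz, T. Wedhorn, *Algebraic Geometry II* (2023), §(27.2), (27.2.1), Def. 27.6 (pp. 606–607).
-/

set_option autoImplicit false

-- Mathlib's `Over`/`Scheme` APIs are stated across semireducible wrappers (as in the ★ `GroupSchemes/*` files).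
set_option backward.isDefEq.respectTransparency false

universe u

open CategoryTheory CategoryTheory.Limits AlgebraicGeometry MonoidalCategory CartesianMonoidalCategory TensorProduct WithConv

noncomputable section

namespace Literature.AlgebraicGeometry.GroupSchemes

namespace AffineGroupScheme

open scoped MonObj

open Literature.AlgebraicGeometry.Motives Literature.NumberTheory.DiophantineGeometry

variable {R : Type u} [CommRing R]

/-! ## §1 The point dictionaries `coord` (★ p845155) and `ptEquiv` (★ p844646) agree on `specOver R H` -/

section Bridge

variable {H : Type u} [CommRing H] [Algebra R H] {R' : Type u} [CommRing R'] [Algebra R R']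

/-- **The coordinates of `Spec ψ : Spec R′ → Spec H` are `ψ`** read through `Γ(Spec R′, 𝒪) ≅ R′` (Mathlib `ΓSpecIso` naturality).
[cite: GortzWedhorn2023, §(27.2) (p. 606)] -/
theorem coord_specOverMapOfAlgHom (ψ : H →ₐ[R] R') :
    coord (AlgPoints.specOverMapOfAlgHom ψ) = (algSpecOverEquiv R').symm.toAlgHom.comp ψ := by
  ext a
  change (Spec.map (CommRingCat.ofHom ψ.toRingHom)).appTop.hom ((Scheme.ΓSpecIso (CommRingCat.of H)).inv.hom a) =
    (Scheme.ΓSpecIso (CommRingCat.of R')).inv.hom (ψ a)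
  have h := congrArg (fun φ => φ.hom a) (Scheme.ΓSpecIso_inv_naturality (CommRingCat.ofHom ψ.toRingHom))
  simp only [CommRingCat.hom_comp, RingHom.coe_comp, Function.comp_apply, CommRingCat.hom_ofHom] at h
  exact h.symm

variable [IsAffine (specOver R H).left]

/-- **The two point dictionaries agree**: for `u : Spec R′ → Spec H` over `R`, `(Γ(Spec R′) ≅ R′) ∘ coord u = ptEquiv u ∘ (Γ(Spec H) ≅ H)⁻¹`
(both are «the» algebra map `ψ` with `u = Spec ψ`, ★ `eq_specOverMapOfAlgHom`). [cite: GortzWedhorn2023, §(27.2) (p. 606)] -/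
theorem algSpecOverEquiv_comp_coord (u : specOver R R' ⟶ specOver R H) :
    (algSpecOverEquiv R').toAlgHom.comp (coord u) = (ptEquiv (specOver R H) R' u).comp (algSpecOverEquiv H).symm.toAlgHom := by
  conv_lhs => rw [eq_specOverMapOfAlgHom u]
  rw [coord_specOverMapOfAlgHom, ← AlgHom.comp_assoc, AlgEquiv.comp_symm, AlgHom.id_comp]

end Bridge

/-! ## §2 The functorial group law of `Spec H` is the convolution law of `H`, read through `Γ(Spec H) ≅ H` -/

section Law

variable (R) (H : Type u) [CommRing H] [HopfAlgebra R H] [IsAffine (specOver R H).left] {R' : Type u} [CommRing R'] [Algebra R R']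

/-- **Products of points**: `(φ · χ) ∘ e⁻¹ = (φ ∘ e⁻¹) ⋆ (χ ∘ e⁻¹)` — the law `groupLaw (specOver R H)` of the group object
`grpObjOfHopfAlgebra R H` is the convolution law `lawOfHopfAlgebra R H` transported along `e := algSpecOverEquiv H`.
[cite: GortzWedhorn2023, §(27.2) (27.2.1) and Definition 27.6 (pp. 606–607)] -/
theorem groupLaw_mul_comp_algSpecOverEquiv_symm (φ χ : Alg (specOver R H) →ₐ[R] R') :
    letI := grpObjOfHopfAlgebra R H
    ((groupLaw (specOver R H)).mul φ χ).comp (algSpecOverEquiv H).symm.toAlgHom =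
      (lawOfHopfAlgebra R H).mul (φ.comp (algSpecOverEquiv H).symm.toAlgHom) (χ.comp (algSpecOverEquiv H).symm.toAlgHom) := by
  letI := grpObjOfHopfAlgebra R H
  obtain ⟨u, rfl⟩ := (ptEquiv (specOver R H) R').surjective φ
  obtain ⟨v, rfl⟩ := (ptEquiv (specOver R H) R').surjective χ
  rw [groupLaw_mul_apply, ← algSpecOverEquiv_comp_coord, ← algSpecOverEquiv_comp_coord, ← algSpecOverEquiv_comp_coord, coord_mul_eq,
    lawOfHopfAlgebra_mul, AlgHom.comp_convMul_distrib, ofConv_toConv, ofConv_toConv]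

/-- **The unit point**: `1 ∘ e⁻¹ = η ∘ ε`. [cite: GortzWedhorn2023, §(27.2) (27.2.1) and Definition 27.6 (pp. 606–607)] -/
theorem groupLaw_one_comp_algSpecOverEquiv_symm :
    letI := grpObjOfHopfAlgebra R H
    ((groupLaw (specOver R H)).one R').comp (algSpecOverEquiv H).symm.toAlgHom = (lawOfHopfAlgebra R H).one R' := by
  letI := grpObjOfHopfAlgebra R H
  rw [groupLaw_one, ← algSpecOverEquiv_comp_coord, coord_one_eq, lawOfHopfAlgebra_one, AlgHom.convOne_def, AlgHom.convOne_def,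
    ofConv_toConv, ofConv_toConv, ← AlgHom.comp_assoc]
  congr 1
  exact Subsingleton.elim _ _

/-- **Inverses of points**: `φ⁻¹ ∘ e⁻¹ = (φ ∘ e⁻¹) ∘ S`. [cite: GortzWedhorn2023, §(27.2) (27.2.1) and Definition 27.6 (pp. 606–607)] -/
theorem groupLaw_inv_comp_algSpecOverEquiv_symm (φ : Alg (specOver R H) →ₐ[R] R') :
    letI := grpObjOfHopfAlgebra R H
    ((groupLaw (specOver R H)).inv φ).comp (algSpecOverEquiv H).symm.toAlgHom =
      (lawOfHopfAlgebra R H).inv (φ.comp (algSpecOverEquiv H).symm.toAlgHom) := by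
  letI := grpObjOfHopfAlgebra R H
  obtain ⟨u, rfl⟩ := (ptEquiv (specOver R H) R').surjective φ
  rw [groupLaw_inv_apply, ← algSpecOverEquiv_comp_coord, ← algSpecOverEquiv_comp_coord, coord_inv_eq, lawOfHopfAlgebra_inv,
    AlgHom.comp_assoc]

end Law

/-! ## §3 `Γ(Spec H, 𝒪) ≃ H` as bialgebras, commuting with the antipodes -/

section Bridges

variable (G : SchemeOver R) [GrpObj G] [IsAffine G.left]

/-- The comultiplication of the Hopf algebra `Γ(G, 𝒪_G)` (★ `Alg.instHopfAlgebra`) is the `Δ = p₁ · p₂` of its functorial group law.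
[cite: GortzWedhorn2023, §(27.2) (27.2.1) (pp. 606–607)] -/
theorem comulAlgHom_alg_eq : Bialgebra.comulAlgHom R (Alg G) = (groupLaw G).comul :=
  AlgHom.toLinearMap_injective rfl

/-- The counit of `Γ(G, 𝒪_G)` is the unit point of its functorial group law. [cite: GortzWedhorn2023, §(27.2) (27.2.1) (pp. 606–607)] -/
theorem counitAlgHom_alg_eq : Bialgebra.counitAlgHom R (Alg G) = (groupLaw G).counit :=
  AlgHom.toLinearMap_injective rfl

/-- The antipode of `Γ(G, 𝒪_G)` is `id⁻¹` of its functorial group law. [cite: GortzWedhorn2023, §(27.2) (27.2.1) (pp. 606–607)] -/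
theorem antipode_alg_eq : HopfAlgebra.antipode R (A := Alg G) = (groupLaw G).antipodeAlgHom.toLinearMap := rfl

end Bridges

section Hopf

variable (R) (H : Type u) [CommRing H] [HopfAlgebra R H] [IsAffine (specOver R H).left]

/-- `m ∘ ((ι₁ ∘ f) ⊗ (ι₂ ∘ g)) = f ⊗ g`: the convolution of the two coprojections precomposed with `f`, `g` is the tensor map.
[cite: GortzWedhorn2023, §(27.2) (27.2.1) (p. 606)] -/
theorem lmul'_comp_map_includeLeft_comp_includeRight_comp {A B : Type u} [CommRing A] [Algebra R A] [CommRing B] [Algebra R B]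
    (f g : A →ₐ[R] B) :
    (Algebra.TensorProduct.lmul' R (S := B ⊗[R] B)).comp
        (Algebra.TensorProduct.map ((Algebra.TensorProduct.includeLeft : B →ₐ[R] B ⊗[R] B).comp f)
          ((Algebra.TensorProduct.includeRight : B →ₐ[R] B ⊗[R] B).comp g)) =
      Algebra.TensorProduct.map f g := by
  apply Algebra.TensorProduct.ext'
  intro a b
  simp

/-- **`Δ_{Γ(Spec H)} ∘ e⁻¹ = (e⁻¹ ⊗ e⁻¹) ∘ Δ_H`** for `e := algSpecOverEquiv H` and the Hopf structure of `grpObjOfHopfAlgebra R H` on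
`Γ(Spec H, 𝒪)`. [cite: GortzWedhorn2023, §(27.2) (27.2.1) and Definition 27.6 (pp. 606–607)] -/
theorem comulAlgHom_comp_algSpecOverEquiv_symm :
    letI := grpObjOfHopfAlgebra R H
    (Bialgebra.comulAlgHom R (Alg (specOver R H))).comp (algSpecOverEquiv H).symm.toAlgHom =
      (Algebra.TensorProduct.map (algSpecOverEquiv H).symm.toAlgHom (algSpecOverEquiv H).symm.toAlgHom).comp
        (Bialgebra.comulAlgHom R H) := by
  letI := grpObjOfHopfAlgebra R H
  rw [comulAlgHom_alg_eq, CorepGroupLaw.comul_def, groupLaw_mul_comp_algSpecOverEquiv_symm, lawOfHopfAlgebra_mul, AlgHom.convMul_def,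
    ofConv_toConv, ofConv_toConv, ofConv_toConv, ← AlgHom.comp_assoc, lmul'_comp_map_includeLeft_comp_includeRight_comp]

/-- **`(e ⊗ e) ∘ Δ_{Γ(Spec H)} = Δ_H ∘ e`**: `e := algSpecOverEquiv H` commutes with the comultiplications (the shape of Mathlib's
`BialgEquiv.ofAlgEquiv` hypothesis). [cite: GortzWedhorn2023, §(27.2) (27.2.1) and Definition 27.6 (pp. 606–607)] -/
theorem map_algSpecOverEquiv_comp_comulAlgHom :
    letI := grpObjOfHopfAlgebra R H
    (Algebra.TensorProduct.map (algSpecOverEquiv H).toAlgHom (algSpecOverEquiv H).toAlgHom).comp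
        (Bialgebra.comulAlgHom R (Alg (specOver R H))) =
      (Bialgebra.comulAlgHom R H).comp (algSpecOverEquiv H).toAlgHom := by
  letI := grpObjOfHopfAlgebra R H
  have h := congrArg (fun ψ => ((Algebra.TensorProduct.map (algSpecOverEquiv H).toAlgHom (algSpecOverEquiv H).toAlgHom).comp ψ).comp
    (algSpecOverEquiv H).toAlgHom) (comulAlgHom_comp_algSpecOverEquiv_symm R H)
  rw [AlgHom.comp_assoc, AlgHom.comp_assoc, AlgEquiv.symm_comp, AlgHom.comp_id] at h
  simp only [← AlgHom.comp_assoc] at h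
  rw [← Algebra.TensorProduct.map_comp, AlgEquiv.comp_symm, Algebra.TensorProduct.map_id, AlgHom.id_comp] at h
  exact h

/-- **`ε_H ∘ e = ε_{Γ(Spec H)}`**: `e := algSpecOverEquiv H` commutes with the counits. [cite: GortzWedhorn2023, §(27.2) (27.2.1) and Definition 27.6 (pp. 606–607)] -/
theorem counitAlgHom_comp_algSpecOverEquiv :
    letI := grpObjOfHopfAlgebra R H
    (Bialgebra.counitAlgHom R H).comp (algSpecOverEquiv H).toAlgHom = Bialgebra.counitAlgHom R (Alg (specOver R H)) := by
  letI := grpObjOfHopfAlgebra R H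
  have h : (Bialgebra.counitAlgHom R (Alg (specOver R H))).comp (algSpecOverEquiv H).symm.toAlgHom = Bialgebra.counitAlgHom R H := by
    rw [counitAlgHom_alg_eq, CorepGroupLaw.counit, groupLaw_one_comp_algSpecOverEquiv_symm, ← lawOfHopfAlgebra_counit]
    rfl
  rw [← h, AlgHom.comp_assoc, AlgEquiv.symm_comp, AlgHom.comp_id]

/-- **HEAD — the round trip `Γ(Spec H, 𝒪) ≃ H` is an isomorphism of bialgebras** for the Hopf structure that the group object
`grpObjOfHopfAlgebra R H` (★ p845155) puts on `Γ(Spec H, 𝒪)` (★ p844646): [GortzWedhorn2023] §(27.2), Def. 27.6 — the two arrows «affine group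
schemes over `R`» ⇄ «commutative Hopf `R`-algebras» are mutually inverse. [cite: GortzWedhorn2023, §(27.2) (27.2.1) and Definition 27.6 (pp. 606–607)] -/
def algSpecOverBialgEquiv : letI := grpObjOfHopfAlgebra R H; Alg (specOver R H) ≃ₐc[R] H :=
  letI := grpObjOfHopfAlgebra R H
  BialgEquiv.ofAlgEquiv (algSpecOverEquiv H) (counitAlgHom_comp_algSpecOverEquiv R H) (map_algSpecOverEquiv_comp_comulAlgHom R H)

/-- `algSpecOverBialgEquiv` is `algSpecOverEquiv` (= Mathlib `Scheme.ΓSpecIso`) on elements. [cite: GortzWedhorn2023, §(27.2) (p. 606)] -/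
theorem algSpecOverBialgEquiv_apply (a : Alg (specOver R H)) :
    letI := grpObjOfHopfAlgebra R H; algSpecOverBialgEquiv R H a = algSpecOverEquiv H a := rfl

/-- **The round trip commutes with the antipodes**: `e (S a) = S (e a)` — so `algSpecOverBialgEquiv` is an isomorphism of HOPF algebras.
[cite: GortzWedhorn2023, §(27.2) (27.2.1) and Definition 27.6 (pp. 606–607)] -/
theorem algSpecOverEquiv_antipode (a : Alg (specOver R H)) :
    letI := grpObjOfHopfAlgebra R H
    algSpecOverEquiv H (HopfAlgebra.antipode R (A := Alg (specOver R H)) a) = HopfAlgebra.antipode R (A := H) (algSpecOverEquiv H a) := by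
  letI := grpObjOfHopfAlgebra R H
  have h : ((groupLaw (specOver R H)).antipodeAlgHom).comp (algSpecOverEquiv H).symm.toAlgHom =
      (algSpecOverEquiv H).symm.toAlgHom.comp (HopfAlgebra.antipodeAlgHom R H) := by
    rw [CorepGroupLaw.antipodeAlgHom, groupLaw_inv_comp_algSpecOverEquiv_symm, lawOfHopfAlgebra_inv, AlgHom.id_comp]
  have h2 := congrArg (fun ψ => algSpecOverEquiv H (ψ (algSpecOverEquiv H a))) h
  simp only [AlgHom.coe_comp, Function.comp_apply, AlgEquiv.toAlgHom_apply, AlgEquiv.symm_apply_apply, AlgEquiv.apply_symm_apply,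
    HopfAlgebra.antipodeAlgHom_apply] at h2
  rw [← h2, antipode_alg_eq]
  rfl

end Hopf

end AffineGroupScheme

end Literature.AlgebraicGeometry.GroupSchemes

end
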